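import Literature.Computability.Cryptography.Sweep1Proofs
import HarnessLib

/-!
# Liu–Pass, Thm 4.1: a weak one-way function from mild average-case `K^t`-hardness

D-0014 companion of `Sweep1Proofs.lean`, second level of the decomposition of
`Literature.Computability.Cryptography.OWFExist_iff_isMildlyHardOnAverage_liuPassKt` (crypto-foundations.S02).
It **proves** the reduction of Liu–Pass's Thm 4.1 (arXiv:2009.11514, §4, "OWFs from Mild
Avg-case `K^t`-Hardness") for the tree's abstract efficient universal machine
`Literature.Computability.MetaComplexity.UniversalMachine`, down to the two efficiency claims of the printed proof, which
are vendored as named facts because the tree's TM2 computability layer does not yet prove closure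
of polynomial time under composition (`Literature.Computability.Complexity.PolyTimeComputable.comp` is a named fact):

* `liuPassOWF U t c` — Liu–Pass's candidate `f(ℓ ‖ Π') = ℓ ‖ U(Π'_{≤ ℓ}, 1^{t(n)})`, rendered
  over all input lengths (`n = n(L)`, `lpLen`), output tagged with `1^L`;
* `liuPassHeur U t c j 𝒜` — the printed heuristic `ℋ`: run the inverter `𝒜` on `(i ‖ z)` for
  all `i ≤ n + c`, verify with `U`, output the least verified `i` (slot `j ∈ {0,1}` selects one of
  the at most two input lengths `L` with `n(L) = n`, `exists_eq_lpBase_add`);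
* `liuPassKt_le_of_eq_lpTarget`, `liuPassOWF_lpPre`, `liuPassHeur_run_eq` — soundness and
  completeness of the verification: `ℋ_j(z) = K^t(z)` whenever `𝒜` inverts `f` on
  `⟨1^L, ⟨K^t(z), z⟩⟩`;
* `pr_invert_le_pr_heur`, `two_pow_mul_fail_heur_le` — the averaging step in expectation form:
  `2^n · Pr[ℋ_j fails on U_n] ≤ 2^L · Pr[𝒜 fails on f(U_L)]` (each `z` owns a canonical preimage
  of `⟨1^L, ⟨K^t(z), z⟩⟩`, an injection `{0,1}^n ↪ {0,1}^L`);
* `isWeaklyOneWay_liuPassOWF_of` — **Thm 4.1**: `K^t` mildly HoA ⇒ `f` is `1/q`-weakly one-way,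
  `q(L) = 2^{c+1} (L+1) p(L)`, given the efficiency hypotheses;
* `liuPassOWF_polyTimeComputable`, `liuPassHeur_isPPT` — the efficiency claims (named facts);
* `weakOWFExist_of_isMildlyHardOnAverage_liuPassKt_of` — the level-1 fact
  `weakOWFExist_of_isMildlyHardOnAverage_liuPassKt` of `Sweep1Proofs.lean` from the two efficiency
  facts; `OWFExist_of_isMildlyHardOnAverage_liuPassKt_of` adds Yao's amplification (S05).

## Deviations from print (all documented at the declarations)

1. *All input lengths.* Print defines `f` on `m(n) = n + c + ⌈log(n+c)⌉` and pads; we give every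
   `L` its parameter `n(L) = L - Nat.size L - c` and a `Nat.size L`-bit length field. Up to two
   `L` share an `n`, so the reduction uses two heuristics `ℋ_0, ℋ_1` (both PPT, both eventually
   beaten by mild hardness) instead of one.
2. *Output tagged with `1^L`.* `invertProb` accepts preimages of any length; tagging makes
   preimages of other lengths impossible, so a successful inversion always yields a program for
   `z` at the right budget `t(|z|)`. The inverter receives `1^L` anyway (Goldreich's convention).
3. *Expectation instead of good coins.* Print fixes a good random tape of `𝒜` (Markov) and counts;
   we bound expectations directly, which removes the case distinction and improves
   `q = 2^{2c+3} n p^2` to `2^{c+1}(L+1) p`. `ℋ_j` hands `𝒜` its own coin string unchanged (same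
   coins for all `i`, as in print's `𝒜_r`), so no coin-length computation is needed.
4. *`t(n) ≥ (1+ε)n`.* Print's Thm 4.1 holds for every `t(n) > 0` because print's `U` has Fact 2.1
   (`K^t(x) ≤ |x| + c`) for every `t`; the tree's `UniversalMachine.print` field gives Fact 2.1
   only for budgets `≥ (1+ε)|x|` (`liuPassKt_le_length_add`), whence the hypothesis.

Theorem numbering follows arXiv:2009.11514v1 (Thm 1.1 = §3 Main Thm (a)⇔(b) in `K^{poly}` form,
Def 2.4 mild HoA, Fact 2.1, Thm 4.1, Thm 5.2, Thms 5.5–5.6).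

## References

* Y. Liu, R. Pass, *On one-way functions and Kolmogorov complexity*, FOCS 2020, 1243–1254;
  arXiv:2009.11514, §2.2 (Fact 2.1), Def. 2.4, Thm 4.1 and its proof.
  doi:10.1109/FOCS46700.2020.00118
* O. Goldreich, *Foundations of Cryptography I*, CUP 2001, Def. 2.2.2 (weak one-way), Thm 2.3.2.
* S. Arora, B. Barak, *Computational Complexity: A Modern Approach*, CUP 2009, Thm 1.9, §7.1.
-/

namespace Literature.Computability.Cryptography

open Filter _root_.Computability Complexity MetaComplexity Finset

/-! ### Little-endian binary fields of fixed width -/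

/-- Little-endian value of a bit string: `bitsVal (b :: l) = b + 2 · bitsVal l`. Used to read
the `⌈log (n+c)⌉`-bit length field `ℓ` of Liu–Pass's one-way function candidate.
[Y. Liu, R. Pass, FOCS 2020, §4 (proof of Thm 4.1) ("where `i` is represented as a `⌈log(n+c)⌉` bit string")]
[folklore] -/
def bitsVal : List Bool → ℕ
  | [] => 0
  | b :: l => b.toNat + 2 * bitsVal l

/-- The width-`D` little-endian binary representation of `w` (exact for `w < 2 ^ D`).
[folklore] -/
def natBits : ℕ → ℕ → List Bool
  | 0, _ => []
  | D + 1, w => decide (w % 2 = 1) :: natBits D (w / 2)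

/-- `bitsVal [] = 0`. [folklore] -/
@[simp] theorem bitsVal_nil : bitsVal [] = 0 := rfl

/-- `bitsVal (b :: l) = b + 2 · bitsVal l`. [folklore] -/
@[simp] theorem bitsVal_cons (b : Bool) (l : List Bool) :
    bitsVal (b :: l) = b.toNat + 2 * bitsVal l := rfl

/-- `natBits D w` has length `D`. [folklore] -/
@[simp] theorem length_natBits : ∀ (D w : ℕ), (natBits D w).length = D
  | 0, _ => rfl
  | D + 1, w => by simp [natBits, length_natBits D]

/-- Reading back a width-`D` field: `bitsVal (natBits D w) = w` for `w < 2 ^ D`. [folklore] -/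
theorem bitsVal_natBits : ∀ {D w : ℕ}, w < 2 ^ D → bitsVal (natBits D w) = w
  | 0, w, h => by simp at h; simp [natBits, h]
  | D + 1, w, h => by
    have h2 : w / 2 < 2 ^ D := by
      rw [pow_succ] at h
      omega
    simp only [natBits, bitsVal_cons, bitsVal_natBits h2]
    rcases Nat.mod_two_eq_zero_or_one w with h0 | h1
    · simp [h0]
      omega
    · simp [h1]
      omega

/-! ### Liu–Pass's one-way function candidate, over all input lengths -/

section Construction

variable (U : UniversalMachine) (t : Polynomial ℕ) (c : ℕ)

/-- Encoding of the universal machine's `Option`-valued output inside the candidate's output: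
`none ↦ [false]`, `some y ↦ true :: y` (the convention of `Computability.Encoding.optionBool`).
[folklore] -/
def encOpt : Option (List Bool) → List Bool
  | none => [false]
  | some y => true :: y

/-- `encOpt (some y) = 1 y`. [folklore] -/
@[simp] theorem encOpt_some (y : List Bool) : encOpt (some y) = true :: y := rfl

/-- `encOpt none = 0`. [folklore] -/
@[simp] theorem encOpt_none : encOpt none = [false] := rfl

/-- `encOpt` is injective (tag bit, then the payload verbatim). [folklore] -/
theorem encOpt_injective : Function.Injective encOpt := by
  intro a b h
  cases a <;> cases b <;> simp_all [encOpt]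

/-- The parameter `n = n(L)` attached to input length `L`: `L = D(L) + (n + c)` with
`D(L) = Nat.size L` the width of the length field (so every `ℓ ≤ n + c ≤ L < 2^{D(L)}` fits).
[Y. Liu, R. Pass, FOCS 2020, §4 (proof of Thm 4.1) (`m = n + c + ⌈log(n+c)⌉`)] [cite: LiuPassFOCS2020, Thm 4.1 (proof)] -/
def lpLen (L : ℕ) : ℕ := L - Nat.size L - c

/-- **Liu–Pass's weak one-way function candidate** `f` (FOCS 2020, proof of Thm 4.1 "OWFs from
mild avg-case `K^t`-hardness"), rendered over all input lengths. On an input `x` of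
length `L`, write `D = Nat.size L`, `n = L - D - c`, split `x = ℓ ‖ Π'` with `|ℓ| = D`, read
`ℓ` in binary and let `Π` be the `ℓ`-bit prefix of `Π'`; the output is
`⟨1^L, ⟨ℓ, U(Π, 1^{t(n)})⟩⟩` (pairing `boolPair`, the universal machine's `Option` output via
`encOpt`). Deviations from print, both invertibility-neutral: (i) Liu–Pass define `f` on the
lengths `m = n + c + ⌈log(n+c)⌉` and extend by truncation-padding, we instead attach to *every*
`L` its own `n(L)` (`lpLen`) and field width `Nat.size L`; (ii) the input length `1^L` is
repeated in the output (the inverter receives `1^L` anyway), which makes preimages of *other*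
lengths — allowed by `invertProb` — impossible. [Y. Liu, R. Pass, FOCS 2020, proof of Thm 4.1;
arXiv:2009.11514, §4]
[cite: LiuPassFOCS2020, Thm 4.1 (proof)] -/
noncomputable def liuPassOWF (x : List Bool) : List Bool :=
  boolPair (unaryEncodeNat x.length)
    (boolPair (x.take (Nat.size x.length))
      (encOpt (U.run ((x.drop (Nat.size x.length)).take (bitsVal (x.take (Nat.size x.length))))
        (t.eval (lpLen c x.length)))))

/-- The point `y = ⟨1^L, ⟨i, z⟩⟩` of the range of `f` queried by the heuristic: "`𝒜(i ‖ z)`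
where `i` is represented as a `⌈log(n+c)⌉` bit string". [Y. Liu, R. Pass, FOCS 2020, §4 (proof of Thm 4.1)]
[cite: LiuPassFOCS2020, Thm 4.1 (proof)] -/
def lpTarget (L i : ℕ) (z : List Bool) : List Bool :=
  boolPair (unaryEncodeNat L) (boolPair (natBits (Nat.size L) i) (encOpt (some z)))

/-- The inverter's query `⟨1^L, y⟩` for the target `y = lpTarget L i z` (the input convention of
`invertProb`). [Goldreich 2001, Def. 2.2.1] [cite: LiuPassFOCS2020, Thm 4.1 (proof)] -/
def lpQuery (L i : ℕ) (z : List Bool) : List Bool :=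
  boolPair (unaryEncodeNat L) (lpTarget L i z)

/-- The candidate input lengths `L` with `n(L) = n` (there are at most two, consecutive), listed
by brute force below `2(n+c) + 3`. [Y. Liu, R. Pass, FOCS 2020, §4 (proof of Thm 4.1)] [cite: LiuPassFOCS2020, Thm 4.1 (proof)] -/
def lpCand (n : ℕ) : List ℕ :=
  (List.range (2 * (n + c) + 3)).filter fun L => n + c + Nat.size L = L

/-- Length of the query `lpQuery L i z` for `|z| = n` (independent of `i` and of the bits of
`z`). [folklore] -/
def lpQueryLen (n L : ℕ) : ℕ :=
  2 * L + 2 + (2 * L + 2 + (2 * Nat.size L + 2 + (n + 1)))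

/-- Minimum of a list of naturals with a default for the empty list. [folklore] -/
def minD (d : ℕ) (l : List ℕ) : ℕ := l.foldr min d

/-- The least candidate input length for parameter `n` (junk `2(n+c)+3` if there is none). All
candidates lie in `{lpBase c n, lpBase c n + 1}` (`exists_eq_lpBase_add`). [folklore] -/
def lpBase (n : ℕ) : ℕ := minD (2 * (n + c) + 3) (lpCand c n)

/-- **Liu–Pass's heuristic `ℋ` for `K^t`** built from an inverter `𝒜` of `f = liuPassOWF U t c`
(FOCS 2020, proof of Thm 4.1), in the slot `j ∈ {0, 1}`: on `z ∈ {0,1}^n` and coins `r`, let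
`L = lpBase c n + j` (the `j`-th of the at most two input lengths with `n(L) = n`); for every
`i ≤ n + c` run `𝒜` with coins `r` on `⟨1^L, ⟨1^L, ⟨i, z⟩⟩⟩`, keep those `i` for which `𝒜`'s
answer is a genuine `f`-preimage of `⟨1^L, ⟨i, z⟩⟩` (checked by evaluating `f`, i.e. by running
`U`), and output the least such `i` (junk `n + c + 1` if none). The coin budget on `n`-bit inputs
is *exactly* `𝒜`'s budget on the (common) length of these queries, so `𝒜` is run on correctly
distributed coins — the same coins for all `i`, which is print's "`ℋ_r` runs `𝒜_r(i ‖ z)` for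
all `i ∈ [n+c]` … and outputs the length of the smallest program output by `𝒜_r` that produces
`z` within `t(n)` steps". (Print has one input length `m(n)` per `n` after padding; over all
lengths there are up to two, whence the slot `j` — two heuristics instead of one.)
[Y. Liu, R. Pass, FOCS 2020, proof of Thm 4.1; arXiv:2009.11514, §4] [cite: LiuPassFOCS2020, Thm 4.1 (proof)] -/
noncomputable def liuPassHeur (j : ℕ) (A : RandAlg (List Bool) (List Bool)) :
    RandAlg (List Bool) ℕ where
  run z r :=
    minD (z.length + c + 1)
      ((List.range (z.length + c + 1)).filter fun i =>
        decide (liuPassOWF U t c (A.run (lpQuery (lpBase c z.length + j) i z) r)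
          = lpTarget (lpBase c z.length + j) i z))
  coinLen n := A.coinLen (lpQueryLen n (lpBase c n + j))

end Construction

/-! ### Elementary lemmas on the encodings -/

/-- `|1^n| = n` for Mathlib's `Computability.unaryEncodeNat`. [folklore] -/
@[simp] theorem length_unaryEncodeNat : ∀ n : ℕ, (unaryEncodeNat n).length = n
  | 0 => rfl
  | n + 1 => by simp [unaryEncodeNat, length_unaryEncodeNat n]

/-- Unary encoding is injective (Mathlib's `unary_decode_encode_nat`). [folklore] -/
theorem unaryEncodeNat_injective : Function.Injective unaryEncodeNat := fun a b h => by
  simpa using congr_arg unaryDecodeNat h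

/-- Componentwise form of `Literature.Computability.Complexity.boolPair_injective`. [Arora–Barak 2009, §0.1] [folklore] -/
theorem boolPair_inj {a b a' b' : List Bool} :
    boolPair a b = boolPair a' b' ↔ a = a' ∧ b = b' := by
  constructor
  · intro h
    have := boolPair_injective (a₁ := (a, b)) (a₂ := (a', b')) h
    simpa using this
  · rintro ⟨rfl, rfl⟩
    rfl

/-- Length of the target `⟨1^L, ⟨i, z⟩⟩`. [folklore] -/
@[simp] theorem length_lpTarget (L i : ℕ) (z : List Bool) :
    (lpTarget L i z).length = 2 * L + 2 + (2 * Nat.size L + 2 + (z.length + 1)) := by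
  simp [lpTarget]

/-- Length of the query `⟨1^L, ⟨1^L, ⟨i, z⟩⟩⟩` is `lpQueryLen |z| L`. [folklore] -/
@[simp] theorem length_lpQuery (L i : ℕ) (z : List Bool) :
    (lpQuery L i z).length = lpQueryLen z.length L := by
  simp [lpQuery, lpQueryLen]

/-- The target determines `z`. [folklore] -/
theorem lpTarget_injective_right {L i i' : ℕ} {z z' : List Bool}
    (h : lpTarget L i z = lpTarget L i' z') : z = z' := by
  simp only [lpTarget, boolPair_inj, encOpt_some, List.cons.injEq, true_and] at h
  exact h.2

/-! ### `minD` -/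

/-- `minD d l` is at most every member of `l`. [folklore] -/
theorem minD_le_of_mem {d a : ℕ} : ∀ {l : List ℕ}, a ∈ l → minD d l ≤ a
  | [], h => by simp at h
  | b :: l, h => by
    simp only [minD, List.foldr_cons] at *
    rcases List.mem_cons.mp h with rfl | h
    · exact min_le_left _ _
    · exact (min_le_right _ _).trans (minD_le_of_mem h)

/-- A common lower bound of `l` and `d` bounds `minD d l` from below. [folklore] -/
theorem le_minD {d a : ℕ} : ∀ {l : List ℕ}, (∀ b ∈ l, a ≤ b) → a ≤ d → a ≤ minD d l
  | [], _, hd => hd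
  | b :: l, h, hd => by
    simp only [minD, List.foldr_cons]
    exact le_min (h b (by simp)) (le_minD (fun b' hb' => h b' (by simp [hb'])) hd)

/-! ### Candidate lengths -/

section Deterministic

variable {U : UniversalMachine} {t : Polynomial ℕ} {c : ℕ}

/-- Membership in the candidate list, unfolded. [folklore] -/
theorem mem_lpCand_iff {n L : ℕ} :
    L ∈ lpCand c n ↔ L < 2 * (n + c) + 3 ∧ n + c + Nat.size L = L := by
  simp [lpCand]

/-- `2 k ≤ 2 ^ (k - 1)` for `k ≥ 4`. [folklore] -/
theorem two_mul_le_two_pow_pred {k : ℕ} (hk : 4 ≤ k) : 2 * k ≤ 2 ^ (k - 1) := by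
  obtain ⟨j, rfl⟩ : ∃ j, k = j + 4 := ⟨k - 4, by omega⟩
  rw [show j + 4 - 1 = j + 3 by omega]
  induction j with
  | zero => norm_num
  | succ j ih => rw [show j + 1 + 3 = (j + 3) + 1 by omega, pow_succ]; omega

/-- For `L ≥ 8` the length field is short: `2 · Nat.size L ≤ L`. [folklore] -/
theorem two_mul_size_le {L : ℕ} (hL : 8 ≤ L) : 2 * Nat.size L ≤ L := by
  have h4 : 4 ≤ Nat.size L := by
    have : Nat.size 8 ≤ Nat.size L := Nat.size_le_size hL
    have h8 : Nat.size 8 = 4 := by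
      apply le_antisymm (Nat.size_le.2 (by norm_num))
      exact Nat.lt_size.2 (by norm_num)
    omega
  have h1 : 2 ^ (Nat.size L - 1) ≤ L := Nat.lt_size.1 (by omega)
  exact (two_mul_le_two_pow_pred h4).trans h1

/-- Every `L ≥ max(8, 2c)` is a candidate length for its own parameter `n(L)`. [folklore] -/
theorem self_mem_lpCand {L : ℕ} (hL : 8 ≤ L) (hcL : 2 * c ≤ L) : L ∈ lpCand c (lpLen c L) := by
  have := two_mul_size_le hL
  rw [mem_lpCand_iff]
  unfold lpLen
  omega

/-- `n(L) ≥ L/2 - c` for `L ≥ 8`; in particular `n(L) → ∞`. [folklore] -/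
theorem le_lpLen {L M : ℕ} (hL : 8 ≤ L) (hM : 2 * (M + c) ≤ L) : M ≤ lpLen c L := by
  have := two_mul_size_le hL
  unfold lpLen
  omega

/-- `n(L) ≤ L`. [folklore] -/
theorem lpLen_le (c L : ℕ) : lpLen c L ≤ L := by
  unfold lpLen; omega

/-- `minD d l` is a member of `l` or the default. [folklore] -/
theorem minD_mem_or (d : ℕ) : ∀ l : List ℕ, minD d l ∈ l ∨ minD d l = d
  | [] => Or.inr rfl
  | b :: l => by
    simp only [minD, List.foldr_cons, List.mem_cons]
    rcases le_total b (List.foldr min d l) with h | h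
    · rw [min_eq_left h]; exact Or.inl (Or.inl rfl)
    · rw [min_eq_right h]
      rcases minD_mem_or d l with h' | h'
      · exact Or.inl (Or.inr h')
      · exact Or.inr h'

/-- `d ≤ 2 ^ (d - 1)` for `d ≥ 2`. [folklore] -/
theorem le_two_pow_pred {d : ℕ} (hd : 2 ≤ d) : d ≤ 2 ^ (d - 1) := by
  obtain ⟨e, rfl⟩ : ∃ e, d = e + 2 := ⟨d - 2, by omega⟩
  rw [show e + 2 - 1 = e + 1 by omega]
  induction e with
  | zero => norm_num
  | succ e ih => rw [pow_succ]; omega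

/-- Two candidate lengths for the same parameter differ by at most one (between them the length
field would have to grow by their difference `d ≥ 2`, but `Nat.size` grows by `d` only across a
gap of at least `2^s (2^{d-1} - 1) ≥ d` numbers). Needs `n + c ≥ 1`: for `n + c = 0` the
candidates are `0, 1, 2`. [folklore] -/
theorem le_succ_of_mem_lpCand {n L L' : ℕ} (hn : 0 < n + c) (hL : L ∈ lpCand c n)
    (hL' : L' ∈ lpCand c n) : L' ≤ L + 1 := by
  rw [mem_lpCand_iff] at hL hL'
  by_contra hcon
  push Not at hcon
  have hpos : 0 < L := by omega
  have hmono : Nat.size L ≤ Nat.size L' := Nat.size_le_size (by omega)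
  have h1 : L < 2 ^ Nat.size L := Nat.lt_size_self L
  have hs1 : 1 ≤ Nat.size L := Nat.size_pos.2 hpos
  have hd2 : 2 ≤ Nat.size L' - Nat.size L := by omega
  have h2 : 2 ^ (Nat.size L' - 1) ≤ L' := Nat.lt_size.1 (by omega)
  have h3 : 2 ^ (Nat.size L' - 1) = 2 ^ Nat.size L * 2 ^ (Nat.size L' - Nat.size L - 1) := by
    rw [← pow_add]; congr 1; omega
  have h4 := le_two_pow_pred hd2
  have h5 : 2 ≤ 2 ^ Nat.size L :=
    calc 2 = 2 ^ 1 := by norm_num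
      _ ≤ 2 ^ Nat.size L := Nat.pow_le_pow_right (by norm_num) hs1
  have h6 : 2 ^ Nat.size L + (Nat.size L' - Nat.size L) ≤
      2 ^ Nat.size L * 2 ^ (Nat.size L' - Nat.size L - 1) := by nlinarith
  omega

/-- Every candidate length is `lpBase c n` or `lpBase c n + 1`. [folklore] -/
theorem exists_eq_lpBase_add {n L : ℕ} (hn : 0 < n + c) (hL : L ∈ lpCand c n) :
    ∃ j ≤ 1, L = lpBase c n + j := by
  have hle : lpBase c n ≤ L := minD_le_of_mem hL
  have hmem : lpBase c n ∈ lpCand c n := by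
    rcases minD_mem_or (2 * (n + c) + 3) (lpCand c n) with h | h
    · exact h
    · exfalso
      have := (mem_lpCand_iff.mp hL).1
      unfold lpBase at hle
      omega
  have := le_succ_of_mem_lpCand hn hmem hL
  exact ⟨L - lpBase c n, by omega, by omega⟩

/-! ### Soundness and completeness of the heuristic's test -/

/-- **Soundness of the test.** If some string `x'` is an `f`-preimage of `⟨1^L, ⟨i, z⟩⟩` with
`n(L) = |z|` and `i ≤ |z| + c`, then `K^t(z) ≤ i`: `x'` has length `L`, its length field reads
`i`, and its next `i` bits are a program printing `z` within `t(|z|)` steps.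
[Y. Liu, R. Pass, FOCS 2020, §4 (proof of Thm 4.1)] [cite: LiuPassFOCS2020, Thm 4.1 (proof)] -/
theorem liuPassKt_le_of_eq_lpTarget {z x' : List Bool} {L i : ℕ}
    (hL : z.length + c + Nat.size L = L) (hi : i ≤ z.length + c)
    (h : liuPassOWF U t c x' = lpTarget L i z) : liuPassKt U t z ≤ i := by
  simp only [liuPassOWF, lpTarget, boolPair_inj] at h
  obtain ⟨h1, h2, h3⟩ := h
  have hlen : x'.length = L := unaryEncodeNat_injective h1
  rw [hlen] at h2 h3
  have h3' := encOpt_injective h3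
  have hiD : i < 2 ^ Nat.size L := lt_of_le_of_lt (by omega) (Nat.lt_size_self L)
  rw [h2, bitsVal_natBits hiD] at h3'
  have hn : lpLen c L = z.length := by unfold lpLen; omega
  rw [hn] at h3'
  exact (liuPassKt_le_length h3').trans ((List.length_take_le _ _))

/-- The canonical preimage `natBits D w ++ prog ++ 0^{L - D - w}` of `⟨1^L, ⟨w, z⟩⟩` built from a
program `prog` of length `w` printing `z`. [Y. Liu, R. Pass, FOCS 2020, §4 (proof of Thm 4.1)] [cite: LiuPassFOCS2020, Thm 4.1 (proof)] -/
def lpPre (L w : ℕ) (prog : List Bool) : List Bool :=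
  natBits (Nat.size L) w ++ prog ++ List.replicate (L - Nat.size L - w) false

/-- The canonical preimage has length `L`. [folklore] -/
theorem length_lpPre {L w : ℕ} {prog : List Bool} (hw : Nat.size L + w ≤ L) (hp : prog.length = w) :
    (lpPre L w prog).length = L := by
  simp [lpPre, hp]
  omega

/-- **Completeness of the test.** If `prog` (of length `w ≤ n + c`) prints `z` within `t(n)`
steps and `n(L) = n = |z|`, then the canonical preimage maps to `⟨1^L, ⟨w, z⟩⟩` under `f`.
[Y. Liu, R. Pass, FOCS 2020, §4 (proof of Thm 4.1) ("the output `(w ‖ z)` is sampled … in the one-way function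
experiment")] [cite: LiuPassFOCS2020, Thm 4.1 (proof)] -/
theorem liuPassOWF_lpPre {z prog : List Bool} {L w : ℕ}
    (hL : z.length + c + Nat.size L = L) (hw : w ≤ z.length + c) (hp : prog.length = w)
    (hrun : U.run prog (t.eval z.length) = some z) :
    liuPassOWF U t c (lpPre L w prog) = lpTarget L w z := by
  have hlen : (lpPre L w prog).length = L := length_lpPre (by omega) hp
  have hwD : w < 2 ^ Nat.size L := lt_of_le_of_lt (by omega) (Nat.lt_size_self L)
  have htake : (lpPre L w prog).take (Nat.size L) = natBits (Nat.size L) w := by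
    simp only [lpPre, List.append_assoc]
    exact List.take_left' (length_natBits _ _)
  have hdrop : (lpPre L w prog).drop (Nat.size L) = prog ++ List.replicate (L - Nat.size L - w) false := by
    simp only [lpPre, List.append_assoc]
    exact List.drop_left' (length_natBits _ _)
  have hn : lpLen c L = z.length := by unfold lpLen; omega
  simp only [liuPassOWF, hlen, htake, hdrop, bitsVal_natBits hwD, List.take_left' hp, hn, hrun,
    lpTarget]

/-- **The heuristic is right whenever the inverter is.** If `𝒜` (with the coins `ℋ` hands it)
inverts `f` on `⟨1^L, ⟨w, z⟩⟩` for `w = K^t(z) ≤ |z| + c` and `L` the candidate length of slot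
`j`, then `ℋ_j(z) = K^t(z)`: the index `w` passes the test, and every passing index `i` has
`i ≥ K^t(z)` by soundness. [Y. Liu, R. Pass, FOCS 2020, proof of Thm 4.1 ("Since `ℋ_r(z)` fails
to compute `K^t(z)`, `𝒜_r` must fail to invert `(w ‖ z)`")] [cite: LiuPassFOCS2020, Thm 4.1 (proof)] -/
theorem liuPassHeur_run_eq {A : RandAlg (List Bool) (List Bool)} {z r : List Bool} {L j : ℕ}
    (hL : L ∈ lpCand c z.length) (hLj : L = lpBase c z.length + j)
    (hw : liuPassKt U t z ≤ z.length + c)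
    (hsucc : liuPassOWF U t c (A.run (lpQuery L (liuPassKt U t z) z) r) =
      lpTarget L (liuPassKt U t z) z) :
    (liuPassHeur U t c j A).run z r = liuPassKt U t z := by
  set w := liuPassKt U t z with hw_def
  simp only [liuPassHeur, ← hLj]
  apply le_antisymm
  · apply minD_le_of_mem
    simp only [List.mem_filter, decide_eq_true_eq, List.mem_range]
    exact ⟨by omega, hsucc⟩
  · refine le_minD (fun i hi => ?_) (by omega)
    simp only [List.mem_filter, decide_eq_true_eq, List.mem_range] at hi
    exact liuPassKt_le_of_eq_lpTarget (mem_lpCand_iff.mp hL).2 (by omega) hi.2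

end Deterministic

/-! ### Counting coin strings -/

section Probability

/-- A `RandAlg` probability is a normalised count of coin strings (unfolding `PMF.map` of the
uniform distribution). Dot-notation extension of `Literature.Computability.Complexity.RandAlg`.
[Arora–Barak 2009, §7.1; Mathlib `PMF.toOuterMeasure_uniformOfFintype_apply`] [folklore] -/
theorem _root_.Literature.Computability.Complexity.RandAlg.pr_eq_card_div {α β : Type} (A : RandAlg α β)
    (ea : α → List Bool) (x : α) (E : Set β) {m : ℕ} (hm : A.coinLen (ea x).length = m) :
    A.pr ea x E = (Nat.card {r : List.Vector Bool m | A.run x r.toList ∈ E} : ℝ) / 2 ^ m := by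
  classical
  subst hm
  unfold RandAlg.pr RandAlg.outputPMF
  rw [PMF.toOuterMeasure_map_apply, PMF.toOuterMeasure_uniformOfFintype_apply, card_vector,
    Fintype.card_bool, ENNReal.toReal_div, Fintype.card_eq_nat_card]
  congr 1
  simp

variable {U : UniversalMachine} {t : Polynomial ℕ} {c : ℕ}

/-- **Success transfers from the inverter to the heuristic, in probability.** For `w = K^t(z)`
and `L` the candidate length of slot `j`, the probability (over `𝒜`'s coins) that `𝒜` inverts
`f` on `⟨1^L, ⟨w, z⟩⟩` is at most the probability (over `ℋ_j`'s coins — the same coin space) that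
`ℋ_j(z) = K^t(z)`. [Y. Liu, R. Pass, FOCS 2020, proof of Thm 4.1] [cite: LiuPassFOCS2020, Thm 4.1 (proof)] -/
theorem pr_invert_le_pr_heur (A : RandAlg (List Bool) (List Bool)) {z : List Bool} {L j : ℕ}
    (hL : L ∈ lpCand c z.length) (hLj : L = lpBase c z.length + j)
    (hw : liuPassKt U t z ≤ z.length + c) :
    A.pr id (lpQuery L (liuPassKt U t z) z)
        {x' | liuPassOWF U t c x' = lpTarget L (liuPassKt U t z) z}
      ≤ (liuPassHeur U t c j A).pr id z {liuPassKt U t z} := by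
  set w := liuPassKt U t z with hw_def
  set q := lpQuery L w z with hq
  set k := A.coinLen q.length with hk_def
  have hK : (liuPassHeur U t c j A).coinLen (id z).length = k := by
    simp [liuPassHeur, hk_def, hq, ← hLj]
  rw [A.pr_eq_card_div id q _ (m := k) rfl, (liuPassHeur U t c j A).pr_eq_card_div id z _ hK]
  have hsub : {r : List.Vector Bool k | A.run q r.toList ∈
        {x' | liuPassOWF U t c x' = lpTarget L w z}} ⊆
      {r : List.Vector Bool k | (liuPassHeur U t c j A).run z r.toList ∈ ({w} : Set ℕ)} := by
    intro R hR
    simp only [Set.mem_setOf_eq, Set.mem_singleton_iff] at hR ⊢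
    exact liuPassHeur_run_eq hL hLj hw hR
  have hle := Nat.card_mono (Set.toFinite _) hsub
  gcongr

end Probability

/-! ### The averaging argument (Liu–Pass 2020, proof of Thm 4.1) -/

section Main

variable {U : UniversalMachine} {t : Polynomial ℕ} {c : ℕ}

/-- A sum of nonnegative reals over an injective image is at most the full sum. [folklore] -/
theorem sum_comp_le_of_injective {ι κ : Type} [Fintype ι] [Fintype κ] {e : ι → κ}
    (he : Function.Injective e) (g : κ → ℝ) (hg : ∀ x, 0 ≤ g x) : ∑ i, g (e i) ≤ ∑ x, g x := by
  have h := Finset.sum_map univ ⟨e, he⟩ g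
  simp only [Function.Embedding.coeFn_mk] at h
  rw [← h]
  exact Finset.sum_le_sum_of_subset_of_nonneg (subset_univ _) fun x _ _ => hg x

/-- **The averaging inequality of Liu–Pass's Thm 4.1**, in expectation form. For a large input
length `L` with parameter `n = n(L)`, if every `z ∈ {0,1}^n` has a shortest program (finiteness of
`K^t`) of length `≤ n + c` (Fact 2.1), then
`2^n · Pr_{z, coins}[ℋ(z) ≠ K^t(z)] ≤ 2^L · Pr_{x ← U_L, coins}[𝒜 fails to invert f(x)]`, i.e. the
heuristic's failure probability is at most `2^{L-n} = 2^{Nat.size L + c}` times the inverter's: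
each `z` owns the canonical preimage `x_z` of `⟨1^L, ⟨K^t(z), z⟩⟩` (an injection `z ↦ x_z`), and on
`x_z` the inverter's success is dominated by the heuristic's success on `z`
(`pr_invert_le_pr_heur`). (Print fixes good coins first and counts `|S| · 2^{-w}/(n+c)`; taking
expectations over the coins directly gives the same bound without the case distinction.)
[Y. Liu, R. Pass, FOCS 2020, proof of Thm 4.1; arXiv:2009.11514, §4] [cite: LiuPassFOCS2020, Thm 4.1 (proof)] -/
theorem two_pow_mul_fail_heur_le (A : RandAlg (List Bool) (List Bool)) {L j : ℕ} (hL8 : 8 ≤ L)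
    (hcL : 2 * c ≤ L) (hLj : L = lpBase c (lpLen c L) + j)
    (hfin : ∀ z : List Bool, z.length = lpLen c L →
      ∃ prog : List Bool, prog.length = liuPassKt U t z ∧ U.run prog (t.eval z.length) = some z)
    (hbd : ∀ z : List Bool, z.length = lpLen c L → liuPassKt U t z ≤ z.length + c) :
    (2 : ℝ) ^ lpLen c L *
        (1 - avgSuccessProb (liuPassKt U t) (liuPassHeur U t c j A) (lpLen c L))
      ≤ 2 ^ L * (1 - invertProb (liuPassOWF U t c) A L) := by
  set n := lpLen c L with hn
  have hsz := two_mul_size_le hL8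
  have hnL : n + c + Nat.size L = L := by rw [hn]; unfold lpLen; omega
  have hcand : L ∈ lpCand c n := self_mem_lpCand hL8 hcL
  -- both sides as sums of failure probabilities
  have lhs : (2 : ℝ) ^ n * (1 - avgSuccessProb (liuPassKt U t) (liuPassHeur U t c j A) n) =
      ∑ z : List.Vector Bool n,
        (1 - (liuPassHeur U t c j A).pr id z.toList {liuPassKt U t z.toList}) := by
    unfold avgSuccessProb uniformAvg
    rw [Finset.sum_sub_distrib, Finset.sum_const, card_univ, card_vector, Fintype.card_bool,
      nsmul_eq_mul, mul_one, mul_sub, mul_one, mul_div_cancel₀ _ (by positivity)]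
    push_cast
    ring
  have rhs : (2 : ℝ) ^ L * (1 - invertProb (liuPassOWF U t c) A L) =
      ∑ x : List.Vector Bool L, (1 - A.pr id (boolPair (unaryEncodeNat L) (liuPassOWF U t c x.toList))
        {x' | liuPassOWF U t c x' = liuPassOWF U t c x.toList}) := by
    unfold invertProb uniformAvg
    rw [Finset.sum_sub_distrib, Finset.sum_const, card_univ, card_vector, Fintype.card_bool,
      nsmul_eq_mul, mul_one, mul_sub, mul_one, mul_div_cancel₀ _ (by positivity)]
    push_cast
    ring
  rw [lhs, rhs]
  -- the injection `z ↦ x_z`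
  choose prog hprog using hfin
  have hlenz : ∀ z : List.Vector Bool n, z.toList.length = n := fun z => z.toList_length
  let ι : List.Vector Bool n → List.Vector Bool L := fun z =>
    ⟨lpPre L (liuPassKt U t z.toList) (prog z.toList (hlenz z)),
      length_lpPre (by have := hbd z.toList (hlenz z); rw [hlenz z] at this; omega)
        (hprog z.toList (hlenz z)).1⟩
  have hfι : ∀ z : List.Vector Bool n,
      liuPassOWF U t c (ι z).toList = lpTarget L (liuPassKt U t z.toList) z.toList := fun z => by
    have hb := hbd z.toList (hlenz z)
    exact liuPassOWF_lpPre (by rw [hlenz z]; omega) hb (hprog z.toList (hlenz z)).1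
      (hprog z.toList (hlenz z)).2
  have hinj : Function.Injective ι := fun z z' h =>
    List.Vector.eq _ _ (lpTarget_injective_right (by rw [← hfι z, ← hfι z', h]))
  calc ∑ z : List.Vector Bool n,
        (1 - (liuPassHeur U t c j A).pr id z.toList {liuPassKt U t z.toList})
      ≤ ∑ z : List.Vector Bool n, (1 - A.pr id (boolPair (unaryEncodeNat L) (liuPassOWF U t c (ι z).toList))
        {x' | liuPassOWF U t c x' = liuPassOWF U t c (ι z).toList}) := by
        refine Finset.sum_le_sum fun z _ => sub_le_sub_left ?_ 1
        rw [hfι z]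
        exact pr_invert_le_pr_heur A (by rw [hlenz z]; exact hcand) (by rw [hlenz z]; exact hLj)
          (by have := hbd z.toList (hlenz z); rwa [hlenz z] at this ⊢)
    _ ≤ ∑ x : List.Vector Bool L, (1 - A.pr id (boolPair (unaryEncodeNat L) (liuPassOWF U t c x.toList))
        {x' | liuPassOWF U t c x' = liuPassOWF U t c x.toList}) :=
        sum_comp_le_of_injective hinj (fun x : List.Vector Bool L => 1 - A.pr id
          (boolPair (unaryEncodeNat L) (liuPassOWF U t c x.toList))
            {x' | liuPassOWF U t c x' = liuPassOWF U t c x.toList})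
          fun x => sub_nonneg.2 (RandAlg.pr_le_one _ _ _ _)

/-- **Liu–Pass 2020, Thm 4.1, for the tree's abstract universal machine — the mathematical
content.** Let `t(n) ≥ (1+ε)n` and let `c` be a Fact-2.1 constant (`K^t(x) ≤ |x| + c` for long
`x`, `liuPassKt_le_length_add`). If `K^t` is mildly hard-on-average then Liu–Pass's candidate
`f = liuPassOWF U t c` is weakly one-way, with `q(L) = 2^{c+1} (L+1) p(L)` for `p` the hardness
polynomial — *provided* the two efficiency claims of the printed proof hold in the tree's TM2
model: `f` is polynomial-time computable (`hf`) and the heuristics `ℋ_j` built from a PPT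
inverter `𝒜` are PPT (`hH`; only the slots `j = 0, 1` are used). These are the named facts `liuPassOWF_polyTimeComputable`, `liuPassHeur_isPPT` below;
everything else (the reduction and its analysis) is proved here. Print has
`q(n) = 2^{2c+3} n p(n)^2` in the parameter `n`; our `q` is in the input length `L` and profits
from taking expectations over the coins instead of fixing good coins.
[Y. Liu, R. Pass, FOCS 2020, Thm 4.1; arXiv:2009.11514, §4] [cite: LiuPassFOCS2020, Thm 4.1] -/
theorem isWeaklyOneWay_liuPassOWF_of {ε : ℝ} (hε : 0 < ε)
    (ht : ∀ n : ℕ, (1 + ε) * n ≤ ((t.eval n : ℕ) : ℝ))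
    {n₀ : ℕ} (hc : ∀ x : List Bool, n₀ ≤ x.length → liuPassKt U t x ≤ x.length + c)
    (hf : PolyTimeComputable id id (liuPassOWF U t c))
    (hH : ∀ (j : ℕ) (A : RandAlg (List Bool) (List Bool)), IsPPT A id →
      IsPPT (liuPassHeur U t c j A) encodeNat)
    (hK : IsMildlyHardOnAverage encodeNat (liuPassKt U t)) :
    IsWeaklyOneWay (liuPassOWF U t c) := by
  obtain ⟨p, hp, hhard⟩ := hK
  -- finiteness of `K^t` on long strings (Fact 2.1 via `print`), giving shortest programs
  obtain ⟨n₁, hn₁⟩ := U.kt_lt_top_of_le hε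
  have hfin : ∀ z : List Bool, n₁ ≤ z.length →
      ∃ prog : List Bool, prog.length = liuPassKt U t z ∧ U.run prog (t.eval z.length) = some z := by
    intro z hz
    have hlt := hn₁ z hz (t.eval z.length) (Nat.ceil_le.2 (ht z.length))
    obtain ⟨prog₀, hprog₀⟩ := U.ktAt_lt_top_iff.1 hlt
    have hne : {m : ℕ | ∃ prog : List Bool, prog.length = m ∧
        U.run prog (t.eval z.length) = some z}.Nonempty := ⟨_, prog₀, rfl, hprog₀⟩
    obtain ⟨prog, hlen, hrun⟩ := Nat.sInf_mem hne
    exact ⟨prog, by rw [liuPassKt_eq_sInf]; exact hlen, hrun⟩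
  have hmono : ∀ {a b : ℕ}, a ≤ b → p.eval a ≤ p.eval b := fun hab => by
    rw [Polynomial.eval_eq_sum_range, Polynomial.eval_eq_sum_range]
    exact Finset.sum_le_sum fun i _ => Nat.mul_le_mul_left _ (Nat.pow_le_pow_left hab i)
  refine ⟨hf, Polynomial.C (2 ^ (c + 1)) * (Polynomial.X + 1) * p, fun m => ?_, fun A hA => ?_⟩
  · have := hp m
    simp only [Polynomial.eval_mul, Polynomial.eval_C, Polynomial.eval_add, Polynomial.eval_X,
      Polynomial.eval_one]
    positivity
  · have hev0 := hhard _ (hH 0 A hA)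
    have hev1 := hhard _ (hH 1 A hA)
    rw [Filter.eventually_atTop] at hev0 hev1 ⊢
    obtain ⟨N₀, hN₀⟩ := hev0
    obtain ⟨N₁, hN₁⟩ := hev1
    set N := max (max N₀ N₁) 1 with hNdef
    refine ⟨max 8 (2 * (max N (max n₀ n₁) + c)), fun L hL => ?_⟩
    have hL8 : 8 ≤ L := le_of_max_le_left hL
    have hL2 : 2 * (max N (max n₀ n₁) + c) ≤ L := le_of_max_le_right hL
    have hMn : max N (max n₀ n₁) ≤ lpLen c L := le_lpLen hL8 hL2
    set n := lpLen c L with hn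
    have hsz := two_mul_size_le hL8
    have hnL : n + c + Nat.size L = L := by rw [hn]; unfold lpLen; omega
    -- the slot `j ∈ {0,1}` of `L` among the candidate lengths for `n`
    obtain ⟨j, hj1, hLj⟩ := exists_eq_lpBase_add (by omega) (self_mem_lpCand (c := c) hL8 (by omega))
    have hmain := two_pow_mul_fail_heur_le (U := U) (t := t) A hL8 (by omega) hLj
      (fun z hz => hfin z (by rw [hz, ← hn]; omega)) (fun z hz => hc z (by rw [hz, ← hn]; omega))
    have havg : avgSuccessProb (liuPassKt U t) (liuPassHeur U t c j A) n ≤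
        1 - 1 / ((p.eval n : ℕ) : ℝ) := by
      interval_cases j
      · exact hN₀ n (by omega)
      · exact hN₁ n (by omega)
    have hpn : (0 : ℝ) < p.eval n := by exact_mod_cast hp n
    -- `2^n / p(n) ≤ 2^L · Pr[𝒜 fails]`
    have h1 : (2 : ℝ) ^ n / p.eval n ≤ 2 ^ L * (1 - invertProb (liuPassOWF U t c) A L) := by
      calc (2 : ℝ) ^ n / p.eval n = 2 ^ n * (1 / p.eval n) := by ring
        _ ≤ 2 ^ n * (1 - avgSuccessProb (liuPassKt U t) (liuPassHeur U t c j A) n) :=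
            mul_le_mul_of_nonneg_left (by linarith) (by positivity)
        _ ≤ 2 ^ L * (1 - invertProb (liuPassOWF U t c) A L) := hmain
    -- `2^{L-n} p(n) ≤ q(L)` in `ℕ`
    have hsizeL : 2 ^ Nat.size L ≤ 2 * (L + 1) := by
      have hpos : 0 < Nat.size L := Nat.size_pos.2 (by omega)
      have h := Nat.lt_size.1 (show Nat.size L - 1 < Nat.size L by omega)
      have hs : Nat.size L = (Nat.size L - 1) + 1 := by omega
      rw [hs, pow_succ]
      omega
    have hnat : p.eval n * 2 ^ L ≤ 2 ^ n * (2 ^ (c + 1) * (L + 1) * p.eval L) := by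
      calc p.eval n * 2 ^ L = 2 ^ n * (2 ^ Nat.size L * 2 ^ c * p.eval n) := by
              conv_lhs => rw [← hnL]
              rw [pow_add, pow_add]
              ring
        _ ≤ 2 ^ n * (2 * (L + 1) * 2 ^ c * p.eval L) := by
              gcongr
              exact hmono (lpLen_le c L)
        _ = 2 ^ n * (2 ^ (c + 1) * (L + 1) * p.eval L) := by ring
    have hq : ((((Polynomial.C (2 ^ (c + 1)) * (Polynomial.X + 1) * p).eval L : ℕ) : ℝ)) =
        ((2 ^ (c + 1) * (L + 1) * p.eval L : ℕ) : ℝ) := by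
      simp only [Polynomial.eval_mul, Polynomial.eval_C, Polynomial.eval_add, Polynomial.eval_X,
        Polynomial.eval_one]
    rw [hq]
    have hQ : (0 : ℝ) < ((2 ^ (c + 1) * (L + 1) * p.eval L : ℕ) : ℝ) := by
      have := hp L
      positivity
    have h2 : (1 : ℝ) / ((2 ^ (c + 1) * (L + 1) * p.eval L : ℕ) : ℝ) ≤ 2 ^ n / p.eval n / 2 ^ L := by
      rw [div_div, div_le_div_iff₀ hQ (by positivity), one_mul]
      exact_mod_cast hnat
    have h3 : (2 : ℝ) ^ n / p.eval n / 2 ^ L ≤ 1 - invertProb (liuPassOWF U t c) A L := by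
      rw [div_le_iff₀ (by positivity)]
      linarith [h1]
    linarith [h2, h3]

end Main

/-! ### The two efficiency claims of the printed proof, as named facts -/

/-- **Efficiency of Liu–Pass's candidate `f`** (FOCS 2020, proof of Thm 4.1 with §2.2: "`U(Π, 1^t)`
can be computed in time `poly(|Π|, t)`"). For every efficient universal machine `U`, polynomial
`t` and constant `c`, the candidate `liuPassOWF U t c` — parse a `Nat.size L`-bit length field,
take a prefix, run `U` for `t(n(L))` steps (`UniversalMachine.polyTime`, budget in unary and
polynomial in `L`), and pair the results with `boolPair` — is polynomial-time computable in the
tree's TM2 sense. Named fact (D-0014): the tree's time-bounded computability layer does not yet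
prove closure under composition (`PolyTimeComputable.comp` is itself a named fact), so this
routine efficiency claim is recorded rather than proved. [Y. Liu, R. Pass, FOCS 2020, §2.2 and
proof of Thm 4.1; S. Arora, B. Barak, *Computational Complexity*, CUP 2009, Thm 1.9]
[cite: LiuPassFOCS2020, §2.2 and Thm 4.1 (proof)] -/
def liuPassOWF_polyTimeComputable : Prop :=
  ∀ (U : UniversalMachine) (t : Polynomial ℕ) (c : ℕ), PolyTimeComputable id id (liuPassOWF U t c)

/-- **Efficiency of Liu–Pass's heuristic `ℋ`** (FOCS 2020, proof of Thm 4.1: "there exists some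
PPT attacker `𝒜` … Our heuristic `ℋ` runs `𝒜(i ‖ z)` for all `i ∈ [n+c]` … and outputs the
length of the smallest program output by `𝒜` that produces the string `z` within `t(n)` steps").
For every PPT inverter `𝒜` (polynomial time on *all* coin strings, polynomially bounded coin
budget: `RandAlg.IsPolyTime`) and every slot `j`, the heuristic `liuPassHeur U t c j 𝒜` — compute
`L = lpBase c n + j` (a minimum over `O(n)` candidates), make `n + c + 1` calls to `𝒜` on queries
`⟨1^L, ⟨1^L, ⟨i, z⟩⟩⟩` of one common length `poly(n)`, handing `𝒜` its own coin string unchanged,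
check each answer by one evaluation of the polynomial-time `f` (`liuPassOWF_polyTimeComputable`),
output the least verified `i` in binary (`encodeNat`); coin budget on `n`-bit inputs *equal* to
`𝒜`'s budget on that query length, hence polynomially bounded (`𝒜`'s bound is an
`ℕ`-polynomial, monotone) — is PPT. Named fact (D-0014) for the same reason as
`liuPassOWF_polyTimeComputable`: closure of TM2 polynomial time under composition and
polynomially bounded loops is not yet available in the tree. [Y. Liu, R. Pass, FOCS 2020, proof
of Thm 4.1; S. Arora, B. Barak, CUP 2009, Thm 1.9 and §7.1] [cite: LiuPassFOCS2020, Thm 4.1 (proof)] -/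
def liuPassHeur_isPPT : Prop :=
  ∀ (U : UniversalMachine) (t : Polynomial ℕ) (c j : ℕ) (A : RandAlg (List Bool) (List Bool)),
    IsPPT A id → IsPPT (liuPassHeur U t c j A) encodeNat

/-- **Liu–Pass 2020, Thm 4.1 (OWFs from mild avg-case `K^t`-hardness), assembled**: the named
fact `weakOWFExist_of_isMildlyHardOnAverage_liuPassKt` of `Sweep1Proofs.lean` follows from the two
efficiency facts, the rest being the real proof `isWeaklyOneWay_liuPassOWF_of` (with the Fact-2.1
constant `c` from `liuPassKt_le_length_add`, which is where the tree needs `t(n) ≥ (1+ε)n`; print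
has Thm 4.1 for every `t(n) > 0`). [Y. Liu, R. Pass, FOCS 2020, Thm 4.1; arXiv:2009.11514, §4]
[cite: LiuPassFOCS2020, Thm 4.1] -/
theorem weakOWFExist_of_isMildlyHardOnAverage_liuPassKt_of
    (hf : liuPassOWF_polyTimeComputable) (hH : liuPassHeur_isPPT) :
    weakOWFExist_of_isMildlyHardOnAverage_liuPassKt := by
  intro U t ε hε ht hK
  obtain ⟨c, n₀, hc⟩ := liuPassKt_le_length_add U t hε ht
  exact ⟨liuPassOWF U t c, isWeaklyOneWay_liuPassOWF_of hε ht hc (hf U t c) (hH U t c) hK⟩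

/-- **S02, direction `←`, from the efficiency facts and Yao's amplification**: for every `U` and
every polynomial `t(n) ≥ (1+ε)n`, if `K^t` is mildly hard-on-average then one-way functions
exist. [Y. Liu, R. Pass, FOCS 2020, Thm 4.1 with Thm 2.3 (= [Yao82]); arXiv:2009.11514]
[cite: LiuPassFOCS2020, Thm 4.1] -/
theorem OWFExist_of_isMildlyHardOnAverage_liuPassKt_of
    (hf : liuPassOWF_polyTimeComputable) (hH : liuPassHeur_isPPT) (hYao : weakOWFExist_iff_OWFExist)
    (U : UniversalMachine) (t : Polynomial ℕ) {ε : ℝ} (hε : 0 < ε)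
    (ht : ∀ n : ℕ, (1 + ε) * n ≤ ((t.eval n : ℕ) : ℝ))
    (hK : IsMildlyHardOnAverage encodeNat (liuPassKt U t)) : OWFExist :=
  OWFExist_of_isMildlyHardOnAverage_liuPassKt
    (weakOWFExist_of_isMildlyHardOnAverage_liuPassKt_of hf hH) hYao U t hε ht hK

/-- **Main Theorem (a) ⇔ (b) (= arXiv Thm 1.1), reduced by one fact**: the corrected `∀ U` form
of S02 now rests on the two efficiency facts of Thm 4.1, Yao's amplification (S05) and the §5
fact `exists_isMildlyHardOnAverage_liuPassKt_of_OWFExist`. [Y. Liu, R. Pass, FOCS 2020, Thm 1.1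
and §3; arXiv:2009.11514] [cite: LiuPassFOCS2020, Thm 1.1] -/
theorem OWFExist_iff_exists_isMildlyHardOnAverage_liuPassKt_of'
    (hf : liuPassOWF_polyTimeComputable) (hH : liuPassHeur_isPPT) (hYao : weakOWFExist_iff_OWFExist)
    (h₅ : exists_isMildlyHardOnAverage_liuPassKt_of_OWFExist) :
    OWFExist_iff_exists_isMildlyHardOnAverage_liuPassKt :=
  OWFExist_iff_exists_isMildlyHardOnAverage_liuPassKt_of
    (weakOWFExist_of_isMildlyHardOnAverage_liuPassKt_of hf hH) hYao h₅

end Literature.Computability.Cryptography
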